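import Summits.SmoothPoincare4.SmoothPoincare4.Theorems.ConvexBisectionAcyclicBisectionExistsCountsLength
import Summits.SmoothPoincare4.SmoothPoincare4.Theorems.ConvexBisectionAcyclicBisectionExistsCountsSpan
import Summits.SmoothPoincare4.SmoothPoincare4.Theorems.ConvexBisectionAcyclicBisectionExistsKasBaseBoundary
import Literature.Topology.FourManifolds.LefschetzBaseBetti
import Literature.Topology.FourManifolds.LefschetzBaseShadow
import HarnessLib

/-!
# NF2 modulo Kas' presentation K2
(sub-goal `stub_modelsOn_counts_of_K2` of stub `stub_modelsOn_counts`, line `modp-braid-orbits`, reshape r9,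
crux `ConvexBisection.AcyclicBisectionExists`, item stmt-SmoothPoincare4-10508; wave 4 / W4-E)

The registered stub `stub_modelsOn_counts` is verbatim the named fact
`LefschetzBase.modelsOn_counts_of_homotopyEquiv_sphere` (Gompf–Stipsicz 1999, §8.2; Etnyre–Fuller 2006, §2):
`M ≃ₕ S⁴`, `ModelsOn M g l ⇒ l.length = 4g ∧ span (classes) = ℚ^{2g} ∧ wordProduct (stdSymp ℤ g) l = 1`.
This file proves it MODULO EXACTLY ONE INPUT, Kas' presentation of the first homology of the boundary of
a Lefschetz handlebody (Kas 1980; Gompf–Stipsicz §8.2; Akbulut–Ozbagci 2001 §2),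

  (K2) `IsLefschetzHandlebody g l X → ∀ bX, (∃ σ, IsChainShadow g σ) →
        H₁(bX.carrier; ℤ) ≃ₗ[ℤ] ℤ^{2g} ⧸ range (wordProduct (stdSymp ℤ g) l − 1)`,

stated with the hypothesis shape of `Kas_K2_of_isLefschetzHandlebody` of the Kas design (lead c3, wave 3;
route: Mayer–Vietoris for `∂X = (∂ Base g ∖ ⋃ Kᵢ) ∪ ⋃ (S³ ∖ S)`, the open book on `∂ Base g`, the
longitude formula, and the landed cokernel algebra `stub_Kas_cokernelPresentation` p121375):

* clause 1 is `stub_modelsOn_counts_length` (`…CountsLength.lean` p121211, Euler characteristics);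
* clause 2 is `stub_modelsOn_counts_span` (`…CountsSpan.lean`, clause 2 of NF5 + the gluing bookkeeping);
* clause 3 is `wordProduct_eq_one_of_seam` (`…StubModelsOnCounts.lean` p113042: an endomorphism of `ℤ^{2g}`
  whose cokernel is `≅ ℤ^{2g}` vanishes, applied across the seam `Ψ : ∂X ≅ ∂ Base g`) fed with (K2) and
  (K1) `stub_Kas_homologyOne_bBase` (`…KasBaseBoundary.lean` p120870: `H₁(∂ Base g; ℤ) ≃ₗ[ℤ] ℤ^{2g}` by
  integral Lefschetz duality), whose three inputs are now theorems: the chain shadow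
  `exists_isChainShadow_of` (`LefschetzBaseShadow.lean` p120043, Milnor 1968 Thm. 9.1) and
  `H₂(Base g; ℤ) = H₃(Base g; ℤ) = 0` (`isZero_singularHomology_base_of_two_le`, `LefschetzBaseBetti.lean`
  p120614).

So after this file NF2 = K2 exactly.  No definitions, no named facts, no `sorry`.
-/

noncomputable section

-- the prescribed namespace `Summit.<P>.<Sub>.…` duplicates `SmoothPoincare4` (P = Sub)
set_option linter.dupNamespace false

open scoped Manifold ContDiff Topology ContinuousMap
open Set Function CategoryTheory CategoryTheory.Limits
open Literature.GroupTheory.CombinatorialGroupTheory.SignedHurwitz Literature.Topology.FourManifolds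
  Literature.Topology.FourManifolds.LefschetzBase Literature.AlgebraicTopology.SingularHomology

namespace Summit.SmoothPoincare4.SmoothPoincare4.Theorems.AcyclicBisectionExists.ModpBraidOrbits

/-- **K1, unconditionally**: `H₁(∂ Base g; ℤ) ≃ₗ[ℤ] ℤ^{2g}` — `stub_Kas_homologyOne_bBase` (integral
Lefschetz duality on the orientable base, p120870) with its three inputs discharged: Milnor's chain shadow
(`exists_isChainShadow_of`) and `H₂(Base g; ℤ) = H₃(Base g; ℤ) = 0`
(`isZero_singularHomology_base_of_two_le`).  On paper: `∂(F_{g,1} × D²) ≅ #^{2g} S¹ × S²`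
(Gompf–Stipsicz 1999, §8.2). [cite: GompfStipsicz1999, §8.2] -/
theorem nonempty_linearEquiv_homologyOne_bBase_pi (g : ℕ) :
    Nonempty (singularHomology ℤ ℤ (bBase g).carrier 1 ≃ₗ[ℤ] (Fin g ⊕ Fin g → ℤ)) :=
  stub_Kas_homologyOne_bBase g (exists_isChainShadow_of g)
    (isZero_singularHomology_base_of_two_le ℤ ℤ g le_rfl)
    (isZero_singularHomology_base_of_two_le ℤ ℤ g (by norm_num))

/-- **Clause 3 of NF2 from K2**: if the boundary of every Lefschetz handlebody of word `l` over the
genus-`g` base has `H₁ ≃ₗ[ℤ] coker (wordProduct (stdSymp ℤ g) l − 1)` (Kas 1980), then every one-sided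
model `ModelsOn M g l` (of ANY `M`) has trivial signed homological monodromy: the seam `Ψ : ∂X ≅ ∂ Base g`
and K1 make the cokernel `≅ ℤ^{2g}`, and `wordProduct_eq_one_of_seam` (rank–nullity over `ℤ`) concludes
(Gompf–Stipsicz 1999, §8.2). [cite: GompfStipsicz1999, §8.2] -/
theorem wordProduct_eq_one_of_modelsOn_of_K2 {g : ℕ} {l : List ((Fin g ⊕ Fin g → ℤ) × Bool)}
    (hK2 : ∀ (X : Type) [TopologicalSpace X] [T2Space X] [SecondCountableTopology X] [CompactSpace X]
      [ChartedSpace (EuclideanHalfSpace 4) X] [IsManifold (𝓡∂ 4) ∞ X],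
      IsLefschetzHandlebody g l X → ∀ bX : BoundaryData (𝓡∂ 4) X (𝓡 3),
        (∃ σ : singularHomology ℤ ℤ (Base g) 1 →ₗ[ℤ] (Fin g ⊕ Fin g → ℤ), IsChainShadow g σ) →
        Nonempty (singularHomology ℤ ℤ bX.carrier 1 ≃ₗ[ℤ]
          ((Fin g ⊕ Fin g → ℤ) ⧸ LinearMap.range (wordProduct (stdSymp ℤ g) l - 1))))
    {M : Type} [TopologicalSpace M] [ChartedSpace (EuclideanSpace ℝ (Fin 4)) M] (hM : ModelsOn M g l) :
    wordProduct (stdSymp ℤ g) l = 1 := by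
  obtain ⟨X, _, _, _, _, _, _, bX, Ψ, hX, -⟩ := hM
  exact wordProduct_eq_one_of_seam bX Ψ (hK2 X hX bX (exists_isChainShadow_of g))
    (nonempty_linearEquiv_homologyOne_bBase_pi g)

/-- **Sub-goal `stub_modelsOn_counts_of_K2` of stub `stub_modelsOn_counts`** (line `modp-braid-orbits`, r9):
NF2 = `LefschetzBase.modelsOn_counts_of_homotopyEquiv_sphere` (Gompf–Stipsicz 1999, §8.2; Etnyre–Fuller
2006, §2) VERBATIM, MODULO Kas' presentation (K2) `H₁(∂X(F; l); ℤ) ≃ₗ[ℤ] coker (wordProduct (stdSymp ℤ g) l − 1)`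
of the boundary of a Lefschetz handlebody (Kas 1980), stated for every boundary datum and given a chain
shadow (the hypothesis shape of the design lemma `Kas_K2_of_isLefschetzHandlebody`): clause 1 by the Euler
count (`stub_modelsOn_counts_length`), clause 2 by clause 2 of NF5 and the gluing bookkeeping
(`stub_modelsOn_counts_span`), clause 3 by K1/K2 across the seam (`wordProduct_eq_one_of_modelsOn_of_K2`).
[cite: GompfStipsicz1999, §8.2] -/
theorem stub_modelsOn_counts_of_K2 :
    (∀ (g : ℕ) (l : List ((Fin g ⊕ Fin g → ℤ) × Bool)) (X : Type) [TopologicalSpace X] [T2Space X]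
      [SecondCountableTopology X] [CompactSpace X] [ChartedSpace (EuclideanHalfSpace 4) X]
      [IsManifold (𝓡∂ 4) ∞ X],
      Literature.Topology.FourManifolds.LefschetzBase.IsLefschetzHandlebody g l X →
      ∀ bX : Literature.Topology.FourManifolds.BoundaryData (𝓡∂ 4) X (𝓡 3),
        (∃ σ : Literature.AlgebraicTopology.SingularHomology.singularHomology ℤ ℤ
            (Literature.Topology.FourManifolds.LefschetzBase.Base g) 1 →ₗ[ℤ] (Fin g ⊕ Fin g → ℤ),
          Literature.Topology.FourManifolds.LefschetzBase.IsChainShadow g σ) →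
        Nonempty ((Literature.AlgebraicTopology.SingularHomology.singularHomology ℤ ℤ bX.carrier 1) ≃ₗ[ℤ]
          ((Fin g ⊕ Fin g → ℤ) ⧸ LinearMap.range
            (Literature.GroupTheory.CombinatorialGroupTheory.SignedHurwitz.wordProduct
              (Literature.GroupTheory.CombinatorialGroupTheory.SignedHurwitz.stdSymp ℤ g) l - 1)))) →
    ∀ (M : Type) [TopologicalSpace M] [T2Space M] [SecondCountableTopology M]
      [ChartedSpace (EuclideanSpace ℝ (Fin 4)) M] [IsManifold (𝓡 4) ∞ M] (g : ℕ)
      (l : List ((Fin g ⊕ Fin g → ℤ) × Bool)),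
      M ≃ₕ Metric.sphere (0 : EuclideanSpace ℝ (Fin 5)) 1 →
      Literature.Topology.FourManifolds.LefschetzBase.ModelsOn M g l →
      l.length = 4 * g ∧
        Submodule.span ℚ (Literature.GroupTheory.CombinatorialGroupTheory.SignedHurwitz.letters
          (Literature.GroupTheory.CombinatorialGroupTheory.SignedHurwitz.ratWord l)) = ⊤ ∧
        Literature.GroupTheory.CombinatorialGroupTheory.SignedHurwitz.wordProduct
          (Literature.GroupTheory.CombinatorialGroupTheory.SignedHurwitz.stdSymp ℤ g) l = 1 :=
  fun hK2 M _ _ _ _ _ g l e hM => ⟨stub_modelsOn_counts_length M g l e hM,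
    stub_modelsOn_counts_span M g l e hM, wordProduct_eq_one_of_modelsOn_of_K2 (hK2 g l) hM⟩

end Summit.SmoothPoincare4.SmoothPoincare4.Theorems.AcyclicBisectionExists.ModpBraidOrbits

end
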